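import Literature.Topology.FourManifolds.EuclideanRegularDomain
import Mathlib.Analysis.SpecialFunctions.SmoothTransition
import Mathlib.Analysis.InnerProductSpace.Calculus

/-!
# Removing a round ball from a compact regular domain of `ℝ^{m+1}` by a defining function

Topic `Literature/Topology/FourManifolds`; continuation of `EuclideanRegularDomain.lean`
(infrastructure for the fact seat
`provefact-Literature.Geometry.Riemannian.LawsonMichelsohn1984_surrounding`).  Everything here is
**proved**; no named fact is introduced.

Lawson–Michelsohn's proof of their Thm. (6.1) (Invent. Math. 77 (1984), §6) starts from a small
round ball `B` inside the compact domain `D = {F ≤ 0}` and reads `D` as `B` with handles attached,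
i.e. it works with the cobordism `(D ∖ B̊; ∂B, ∂D)` (Kervaire–Milnor 1963, proof of Lemma 2.3;
Milnor 1965, §1).  In the level-set idiom this complement is again a compact regular domain: for
a ball `B̄(c, r) ⊆ {F < 0}` the function

  `G = χ(‖x - c‖²) · (r²/4 - ‖x - c‖²) + (1 - χ(‖x - c‖²)) · F`,

with a smooth cutoff `χ = 1` on `(-∞, r²/2]`, `χ = 0` on `[r², ∞)` (`Real.smoothTransition`),
satisfies (`ballRemovalFun`):

* `setOf_ballRemovalFun_nonpos` — `{G ≤ 0} = {F ≤ 0} ∖ B(c, r/2)`;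
* `setOf_ballRemovalFun_eq_zero` — `{G = 0} = S(c, r/2) ⊔ {F = 0}` (disjoint union,
  `disjoint_sphere_setOf_eq_zero`);
* `isRegularCompactDomain_ballRemovalFun` — `G` is smooth, `{G ≤ 0}` is compact and `dG ≠ 0` on
  `{G = 0}` (near the small sphere `G = r²/4 - ‖x - c‖²`, near `{F = 0}` `G = F`).

So `D ∖ B̊(c, r/2)` is the manifold with boundary `(IsRegularCompactDomain G).Domain` of
`EuclideanRegularDomain.lean`, inside `ℝ^{m+1}`, with boundary the round sphere `S(c, r/2)`
together with `∂D`; and `B̄(c, r/2)` is the round `0`-handle from which the surrounding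
hypersurface is grown (`Literature.Geometry.Riemannian.roundBall_presentation`).

## References

* M. Kervaire, J. Milnor, *Groups of homotopy spheres I*, Ann. of Math. 77 (1963), proof of
  Lemma 2.3 (p. 506). [KervaireMilnorAnnals1963]
* H. B. Lawson, Jr., M.-L. Michelsohn, *Embedding and surrounding with positive mean curvature*,
  Invent. Math. 77 (1984), §6. [LawsonMichelsohn1984]
-/

open scoped Manifold ContDiff Topology
open Set Function Metric Filter

noncomputable section

namespace Literature.Topology.FourManifolds

/-! ### The cutoff -/

/-- The smooth cutoff `χ_{a,b}(t) = smoothTransition ((b - t)/(b - a))`: equal to `1` for `t ≤ a`,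
to `0` for `t ≥ b` (`a < b`), with values in `[0, 1]`. [folklore] -/
def ballCutoff (a b t : ℝ) : ℝ := Real.smoothTransition ((b - t) / (b - a))

/-- `χ_{a,b} = 1` on `(-∞, a]`. [folklore] -/
theorem ballCutoff_eq_one {a b t : ℝ} (hab : a < b) (ht : t ≤ a) : ballCutoff a b t = 1 :=
  Real.smoothTransition.one_of_one_le ((one_le_div (sub_pos.2 hab)).2 (by linarith))

/-- `χ_{a,b} = 0` on `[b, ∞)`. [folklore] -/
theorem ballCutoff_eq_zero {a b t : ℝ} (hab : a < b) (ht : b ≤ t) : ballCutoff a b t = 0 :=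
  Real.smoothTransition.zero_of_nonpos (div_nonpos_of_nonpos_of_nonneg (by linarith) (by linarith))

/-- `0 ≤ χ_{a,b}`. [folklore] -/
theorem ballCutoff_nonneg (a b t : ℝ) : 0 ≤ ballCutoff a b t := Real.smoothTransition.nonneg _

/-- `χ_{a,b} ≤ 1`. [folklore] -/
theorem ballCutoff_le_one (a b t : ℝ) : ballCutoff a b t ≤ 1 := Real.smoothTransition.le_one _

/-- `χ_{a,b}` is smooth. [folklore] -/
theorem contDiff_ballCutoff (a b : ℝ) : ContDiff ℝ ∞ (ballCutoff a b) :=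
  (Real.smoothTransition.contDiff (n := ⊤)).comp ((contDiff_const.sub contDiff_id).div_const _)

/-! ### The defining function of `D ∖ B̊(c, r/2)` -/

section Normed

variable {E : Type*} [NormedAddCommGroup E]

/-- **The ball-removal defining function** `G = χ(q)(r²/4 - q) + (1 - χ(q)) F`, `q = ‖x - c‖²`,
`χ = χ_{r²/2, r²}`. [folklore] -/
def ballRemovalFun (F : E → ℝ) (c : E) (r : ℝ) (x : E) : ℝ :=
  ballCutoff (r ^ 2 / 2) (r ^ 2) (‖x - c‖ ^ 2) * (r ^ 2 / 4 - ‖x - c‖ ^ 2) +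
    (1 - ballCutoff (r ^ 2 / 2) (r ^ 2) (‖x - c‖ ^ 2)) * F x

variable {F : E → ℝ} {c : E} {r : ℝ}

/-- Inside radius `r/√2`: `G = r²/4 - ‖x - c‖²`. [folklore] -/
theorem ballRemovalFun_eq_of_le (hr : 0 < r) {x : E} (hx : ‖x - c‖ ^ 2 ≤ r ^ 2 / 2) :
    ballRemovalFun F c r x = r ^ 2 / 4 - ‖x - c‖ ^ 2 := by
  have hab : r ^ 2 / 2 < r ^ 2 := by nlinarith
  simp [ballRemovalFun, ballCutoff_eq_one hab hx]

/-- Outside radius `r`: `G = F`. [folklore] -/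
theorem ballRemovalFun_eq_of_ge (hr : 0 < r) {x : E} (hx : r ^ 2 ≤ ‖x - c‖ ^ 2) :
    ballRemovalFun F c r x = F x := by
  have hab : r ^ 2 / 2 < r ^ 2 := by nlinarith
  simp [ballRemovalFun, ballCutoff_eq_zero hab hx]

/-- On the shell `r/2 < ‖x - c‖ ≤ r` (where `F < 0`): `G < 0`. [folklore] -/
theorem ballRemovalFun_neg_of_mem (hball : ∀ x, ‖x - c‖ ≤ r → F x < 0) {x : E}
    (h1 : r ^ 2 / 4 < ‖x - c‖ ^ 2) (h2 : ‖x - c‖ ≤ r) : ballRemovalFun F c r x < 0 := by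
  have hF : F x < 0 := hball x h2
  set χ := ballCutoff (r ^ 2 / 2) (r ^ 2) (‖x - c‖ ^ 2) with hχ
  have h0 : 0 ≤ χ := ballCutoff_nonneg _ _ _
  have h1' : χ ≤ 1 := ballCutoff_le_one _ _ _
  have hA : r ^ 2 / 4 - ‖x - c‖ ^ 2 < 0 := by linarith
  show χ * (r ^ 2 / 4 - ‖x - c‖ ^ 2) + (1 - χ) * F x < 0
  rcases h0.lt_or_eq with hpos | hzero
  · nlinarith
  · rw [← hzero]; simpa using hF

/-- `‖x - c‖ ≤ r ↔ ‖x - c‖² ≤ r²` for `r ≥ 0`. [folklore] -/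
theorem norm_sub_le_iff_sq (hr : 0 ≤ r) {x : E} : ‖x - c‖ ≤ r ↔ ‖x - c‖ ^ 2 ≤ r ^ 2 :=
  (pow_le_pow_iff_left₀ (norm_nonneg _) hr two_ne_zero).symm

/-- `r/2 ≤ ‖x - c‖ ↔ r²/4 ≤ ‖x - c‖²` for `r ≥ 0`. [folklore] -/
theorem half_le_norm_sub_iff_sq (hr : 0 ≤ r) {x : E} :
    r / 2 ≤ ‖x - c‖ ↔ r ^ 2 / 4 ≤ ‖x - c‖ ^ 2 := by
  rw [show r ^ 2 / 4 = (r / 2) ^ 2 by ring]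
  exact (pow_le_pow_iff_left₀ (by linarith) (norm_nonneg _) two_ne_zero).symm

/-- **`{G ≤ 0} = {F ≤ 0} ∖ B(c, r/2)`** for a ball `B̄(c, r) ⊆ {F < 0}`. [folklore] -/
theorem setOf_ballRemovalFun_nonpos (hr : 0 < r) (hball : ∀ x, ‖x - c‖ ≤ r → F x < 0) :
    {x | ballRemovalFun F c r x ≤ 0} = {x | F x ≤ 0} \ ball c (r / 2) := by
  ext x
  simp only [mem_setOf_eq, Set.mem_sdiff, mem_ball, dist_eq_norm, not_lt]
  rw [half_le_norm_sub_iff_sq hr.le]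
  set q := ‖x - c‖ ^ 2 with hq
  have hq0 : 0 ≤ q := by positivity
  constructor
  · intro hG
    rcases le_or_gt q (r ^ 2 / 2) with h1 | h1
    · rw [ballRemovalFun_eq_of_le hr h1] at hG
      have hxr : ‖x - c‖ ≤ r := (norm_sub_le_iff_sq hr.le).2 (by rw [← hq]; nlinarith)
      exact ⟨(hball x hxr).le, by linarith⟩
    · rcases lt_or_ge q (r ^ 2) with h2 | h2
      · have hxr : ‖x - c‖ ≤ r := (norm_sub_le_iff_sq hr.le).2 (by rw [← hq]; exact h2.le)
        exact ⟨(hball x hxr).le, by nlinarith⟩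
      · rw [ballRemovalFun_eq_of_ge hr h2] at hG
        exact ⟨hG, by nlinarith⟩
  · rintro ⟨hF, hrad⟩
    rcases le_or_gt q (r ^ 2 / 2) with h1 | h1
    · rw [ballRemovalFun_eq_of_le hr h1]; linarith
    · rcases le_or_gt q (r ^ 2) with h2 | h2
      · have hxr : ‖x - c‖ ≤ r := (norm_sub_le_iff_sq hr.le).2 (by rw [← hq]; exact h2)
        exact (ballRemovalFun_neg_of_mem hball (by rw [← hq]; nlinarith) hxr).le
      · rw [ballRemovalFun_eq_of_ge hr h2.le]; exact hF

/-- `‖x - c‖ = r/2 ↔ ‖x - c‖² = r²/4` for `r ≥ 0`. [folklore] -/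
theorem norm_sub_eq_half_iff_sq (hr : 0 ≤ r) {x : E} :
    ‖x - c‖ = r / 2 ↔ ‖x - c‖ ^ 2 = r ^ 2 / 4 := by
  rw [show r ^ 2 / 4 = (r / 2) ^ 2 by ring]
  exact (pow_left_inj₀ (norm_nonneg _) (by linarith) two_ne_zero).symm

/-- **`{G = 0} = S(c, r/2) ∪ {F = 0}`** for a ball `B̄(c, r) ⊆ {F < 0}`. [folklore] -/
theorem setOf_ballRemovalFun_eq_zero (hr : 0 < r) (hball : ∀ x, ‖x - c‖ ≤ r → F x < 0) :
    {x | ballRemovalFun F c r x = 0} = sphere c (r / 2) ∪ {x | F x = 0} := by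
  ext x
  simp only [mem_setOf_eq, mem_union, mem_sphere, dist_eq_norm]
  rw [norm_sub_eq_half_iff_sq hr.le]
  set q := ‖x - c‖ ^ 2 with hq
  have hq0 : 0 ≤ q := by positivity
  constructor
  · intro hG
    rcases le_or_gt q (r ^ 2 / 2) with h1 | h1
    · rw [ballRemovalFun_eq_of_le hr h1] at hG
      exact Or.inl (by linarith)
    · rcases le_or_gt q (r ^ 2) with h2 | h2
      · have hxr : ‖x - c‖ ≤ r := (norm_sub_le_iff_sq hr.le).2 (by rw [← hq]; exact h2)
        have := ballRemovalFun_neg_of_mem hball (by rw [← hq]; nlinarith) hxr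
        exact absurd hG this.ne
      · rw [ballRemovalFun_eq_of_ge hr h2.le] at hG
        exact Or.inr hG
  · rintro (hs | hF)
    · rw [ballRemovalFun_eq_of_le hr (by rw [← hq]; nlinarith)]
      linarith
    · have hxr : r < ‖x - c‖ := by
        by_contra h
        exact (hball x (not_lt.1 h)).ne hF
      have h2 : r ^ 2 ≤ q := by rw [hq]; nlinarith [norm_nonneg (x - c)]
      rw [ballRemovalFun_eq_of_ge hr h2]
      exact hF

/-- The two pieces `S(c, r/2)` and `{F = 0}` of `{G = 0}` are disjoint (the sphere lies in
`{F < 0}`). [folklore] -/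
theorem disjoint_sphere_setOf_eq_zero (hr : 0 < r) (hball : ∀ x, ‖x - c‖ ≤ r → F x < 0) :
    Disjoint (sphere c (r / 2)) {x | F x = 0} := by
  refine disjoint_left.2 fun x hx hF => ?_
  rw [mem_sphere, dist_eq_norm] at hx
  exact (hball x (by rw [hx]; linarith)).ne hF

/-- The sphere `S(c, r/2)` lies in the open sublevel `{F < 0}`. [folklore] -/
theorem sphere_subset_setOf_neg (hr : 0 < r) (hball : ∀ x, ‖x - c‖ ≤ r → F x < 0) :
    sphere c (r / 2) ⊆ {x | F x < 0} := fun x hx => by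
  rw [mem_sphere, dist_eq_norm] at hx
  exact hball x (by rw [hx]; linarith)

/-- Near the small sphere, `G` is the quadratic `r²/4 - ‖· - c‖²`. [folklore] -/
theorem ballRemovalFun_eventuallyEq_quadratic (hr : 0 < r) {x : E} (hx : ‖x - c‖ ^ 2 < r ^ 2 / 2) :
    ballRemovalFun F c r =ᶠ[𝓝 x] fun y => r ^ 2 / 4 - ‖y - c‖ ^ 2 := by
  have hopen : IsOpen {y : E | ‖y - c‖ ^ 2 < r ^ 2 / 2} :=
    isOpen_lt ((continuous_id.sub continuous_const).norm.pow 2) continuous_const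
  filter_upwards [hopen.mem_nhds hx] with y hy
  exact ballRemovalFun_eq_of_le hr (le_of_lt hy)

/-- Away from the ball `B̄(c, r)`, `G` is `F`. [folklore] -/
theorem ballRemovalFun_eventuallyEq (hr : 0 < r) {x : E} (hx : r ^ 2 < ‖x - c‖ ^ 2) :
    ballRemovalFun F c r =ᶠ[𝓝 x] F := by
  have hopen : IsOpen {y : E | r ^ 2 < ‖y - c‖ ^ 2} :=
    isOpen_lt continuous_const ((continuous_id.sub continuous_const).norm.pow 2)
  filter_upwards [hopen.mem_nhds hx] with y hy
  exact ballRemovalFun_eq_of_ge hr (le_of_lt hy)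

/-- `{G ≤ 0}` is compact when `{F ≤ 0}` is. [folklore] -/
theorem isCompact_setOf_ballRemovalFun_nonpos (hr : 0 < r) (hball : ∀ x, ‖x - c‖ ≤ r → F x < 0)
    (hD : IsCompact {x | F x ≤ 0}) :
    IsCompact {x | ballRemovalFun F c r x ≤ 0} := by
  rw [setOf_ballRemovalFun_nonpos hr hball]
  exact hD.diff isOpen_ball

end Normed

/-! ### Smoothness and regularity (inner product space) -/

section Inner

variable {E : Type*} [NormedAddCommGroup E] [InnerProductSpace ℝ E] {F : E → ℝ} {c : E} {r : ℝ}

/-- `G` is smooth when `F` is. [folklore] -/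
theorem contDiff_ballRemovalFun (hF : ContDiff ℝ ∞ F) (c : E) (r : ℝ) :
    ContDiff ℝ ∞ (ballRemovalFun F c r) := by
  have hq : ContDiff ℝ ∞ fun x : E => ‖x - c‖ ^ 2 := (contDiff_id.sub contDiff_const).norm_sq ℝ
  have hχ : ContDiff ℝ ∞ fun x : E => ballCutoff (r ^ 2 / 2) (r ^ 2) (‖x - c‖ ^ 2) :=
    (contDiff_ballCutoff _ _).comp hq
  exact (hχ.mul (contDiff_const.sub hq)).add ((contDiff_const.sub hχ).mul hF)

/-- `dG ≠ 0` on the small sphere: there `dG = -2⟨x - c, ·⟩` and `x ≠ c`. [folklore] -/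
theorem fderiv_ballRemovalFun_ne_zero_of_mem_sphere (hr : 0 < r) {x : E}
    (hx : ‖x - c‖ ^ 2 = r ^ 2 / 4) : fderiv ℝ (ballRemovalFun F c r) x ≠ 0 := by
  have hlt : ‖x - c‖ ^ 2 < r ^ 2 / 2 := by rw [hx]; nlinarith
  rw [(ballRemovalFun_eventuallyEq_quadratic hr hlt).fderiv_eq]
  have hd : HasFDerivAt (fun y : E => r ^ 2 / 4 - ‖y - c‖ ^ 2)
      (0 - (2 : ℝ) • innerSL ℝ (x - c)) x := by
    have h := ((hasStrictFDerivAt_norm_sq (x - c)).hasFDerivAt).comp x (hasFDerivAt_sub_const c)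
    have h2 : HasFDerivAt (fun y : E => ‖y - c‖ ^ 2) ((2 : ℝ) • innerSL ℝ (x - c)) x := by
      refine h.congr_fderiv ?_
      ext v
      simp [two_smul]
    exact (hasFDerivAt_const (r ^ 2 / 4) x).sub h2
  rw [hd.fderiv, zero_sub]
  intro h0
  have h' := DFunLike.congr_fun h0 (x - c)
  rw [neg_apply, smul_apply, innerSL_apply_apply, real_inner_self_eq_norm_sq, hx, zero_apply,
    smul_eq_mul] at h'
  have : r ^ 2 = 0 := by linarith
  exact hr.ne' (by simpa using this)

/-- `dG ≠ 0` on `{F = 0}`: there `G = F` nearby. [folklore] -/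
theorem fderiv_ballRemovalFun_ne_zero_of_eq_zero (hr : 0 < r)
    (hball : ∀ x, ‖x - c‖ ≤ r → F x < 0) (hreg : ∀ x, F x = 0 → fderiv ℝ F x ≠ 0) {x : E}
    (hx : F x = 0) : fderiv ℝ (ballRemovalFun F c r) x ≠ 0 := by
  have hxr : r < ‖x - c‖ := by
    by_contra h
    exact (hball x (not_lt.1 h)).ne hx
  have h2 : r ^ 2 < ‖x - c‖ ^ 2 := by nlinarith [norm_nonneg (x - c)]
  rw [(ballRemovalFun_eventuallyEq hr h2).fderiv_eq]
  exact hreg x hx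

/-- **`dG ≠ 0` on `{G = 0}`.** [folklore] -/
theorem fderiv_ballRemovalFun_ne_zero (hr : 0 < r) (hball : ∀ x, ‖x - c‖ ≤ r → F x < 0)
    (hreg : ∀ x, F x = 0 → fderiv ℝ F x ≠ 0) (x : E) (hx : ballRemovalFun F c r x = 0) :
    fderiv ℝ (ballRemovalFun F c r) x ≠ 0 := by
  have hx' : x ∈ {x | ballRemovalFun F c r x = 0} := hx
  rw [setOf_ballRemovalFun_eq_zero hr hball] at hx'
  rcases hx' with hs | hF
  · rw [mem_sphere, dist_eq_norm, norm_sub_eq_half_iff_sq hr.le] at hs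
    exact fderiv_ballRemovalFun_ne_zero_of_mem_sphere hr hs
  · exact fderiv_ballRemovalFun_ne_zero_of_eq_zero hr hball hreg hF

end Inner

/-! ### Packaging: `D ∖ B̊(c, r/2)` as a compact regular domain of `ℝ^{m+1}` -/

section Euclidean

variable {m : ℕ} {F : EuclideanSpace ℝ (Fin (m + 1)) → ℝ} {c : EuclideanSpace ℝ (Fin (m + 1))}
  {r : ℝ}

/-- **Removing a round ball keeps a compact regular domain**: for `B̄(c, r) ⊆ {F < 0}` and
`F` presenting a compact regular domain, `G = ballRemovalFun F c r` presents the compact regular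
domain `{F ≤ 0} ∖ B(c, r/2)`, bounded by the round sphere `S(c, r/2)` and `{F = 0}`.
[cite: KervaireMilnorAnnals1963, Lemma 2.3, proof (p. 506)] -/
theorem isRegularCompactDomain_ballRemovalFun (h : IsRegularCompactDomain F) (hr : 0 < r)
    (hball : ∀ x, ‖x - c‖ ≤ r → F x < 0) : IsRegularCompactDomain (ballRemovalFun F c r) where
  contDiff := contDiff_ballRemovalFun h.contDiff c r
  isCompact := isCompact_setOf_ballRemovalFun_nonpos hr hball h.isCompact
  fderiv_ne_zero := fderiv_ballRemovalFun_ne_zero hr hball h.fderiv_ne_zero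

/-- The points of the ball-removed domain are the points of `D` outside `B(c, r/2)`.
[folklore] -/
theorem range_incl_ballRemoval (h : IsRegularCompactDomain F) (hr : 0 < r)
    (hball : ∀ x, ‖x - c‖ ≤ r → F x < 0) :
    range (IsRegularCompactDomain.Domain.incl (isRegularCompactDomain_ballRemovalFun h hr hball))
      = {x | F x ≤ 0} \ ball c (r / 2) := by
  rw [IsRegularCompactDomain.Domain.range_incl, setOf_ballRemovalFun_nonpos hr hball]

/-- The boundary of the ball-removed domain is carried by the inclusion onto
`S(c, r/2) ∪ {F = 0}`. [folklore] -/
theorem range_incl_comp_val_boundary_ballRemoval (h : IsRegularCompactDomain F) (hr : 0 < r)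
    (hball : ∀ x, ‖x - c‖ ≤ r → F x < 0) :
    range (fun p : (𝓡∂ (m + 1)).boundary (isRegularCompactDomain_ballRemovalFun h hr hball).Domain
        => IsRegularCompactDomain.Domain.incl _ p.1) = sphere c (r / 2) ∪ {x | F x = 0} := by
  rw [IsRegularCompactDomain.Domain.range_incl_comp_val_boundary,
    setOf_ballRemovalFun_eq_zero hr hball]

/-- **A round ball inside the interior exists**: every compact regular domain with nonempty
zero set contains a closed round ball `B̄(c, r)`, `r > 0`, in `{F < 0}`. [folklore] -/
theorem exists_closedBall_subset_setOf_neg (h : IsRegularCompactDomain F)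
    (hZ : {x | F x = 0}.Nonempty) : ∃ c : EuclideanSpace ℝ (Fin (m + 1)), ∃ r : ℝ, 0 < r ∧
      ∀ x, ‖x - c‖ ≤ r → F x < 0 := by
  have hopen : IsOpen {x : EuclideanSpace ℝ (Fin (m + 1)) | F x < 0} :=
    isOpen_lt h.continuous continuous_const
  obtain ⟨x₀, hx₀⟩ := hZ
  -- a regular zero is in the closure of `{F < 0}`, so that open set is nonempty
  have hne : {x : EuclideanSpace ℝ (Fin (m + 1)) | F x < 0}.Nonempty := by
    by_contra hemp
    rw [not_nonempty_iff_eq_empty] at hemp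
    -- then `F ≥ 0` everywhere and `x₀` is a minimum: `dF(x₀) = 0`
    have hmin : IsLocalMin F x₀ := Filter.Eventually.of_forall fun y => by
      have : ¬ F y < 0 := fun hy => by
        have : y ∈ ({x | F x < 0} : Set _) := hy
        rw [hemp] at this; exact this
      rw [hx₀]; exact not_lt.1 this
    exact h.fderiv_ne_zero x₀ hx₀ hmin.fderiv_eq_zero
  obtain ⟨c, hc⟩ := hne
  obtain ⟨ε, hε, hball⟩ := Metric.isOpen_iff.1 hopen c hc
  refine ⟨c, ε / 2, by linarith, fun x hx => hball (mem_ball.2 ?_)⟩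
  rw [dist_eq_norm]; linarith

end Euclidean

end Literature.Topology.FourManifolds

end
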